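import Literature.Barriers.Schanuel.EFunctionValuesAtAlgebraicPointsLemma4
import Literature.Barriers.Schanuel.EFunctionValuesAtAlgebraicPointsRankStep
import Literature.Barriers.Schanuel.EFunctionValuesAtAlgebraicPointsNonvanishing
import Literature.Barriers.Schanuel.EFunctionValuesAtAlgebraicPointsReduction
import Mathlib.Algebra.Algebra.Hom.Rat
import HarnessLib

/-!
# Barrier (Schanuel) `EFunctionValuesAtAlgebraicPoints`: Shidlovskii's rank theorem holds, and the Siegel–Shidlovskii theorem is discharged — proofs only

`Literature/Barriers/Schanuel/EFunctionValuesAtAlgebraicPointsMainProofs.lean` — final file of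
the programme to discharge `siegelShidlovskii_algIndep` (Siegel–Shidlovskii; Rivoal Thm. 5.10 =
Baker, *Transcendental Number Theory*, Thm. 11.1). It PROVES the named fact
`shidlovskii_rankBound` (`SiegelShidlovskiiRank.lean`, Rivoal Thm. 5.20, first bound
`#ι ≤ [K:ℚ] · rank_K {Fᵢ(α)}`) by bridging the `ℂ`-side hypotheses of that statement to the
number-field data `L4Data` of Baker's Lemma 4 (`…Lemma4.lean`: Lemmas 1–4 of Baker Ch. 11 =
Rivoal 5.13–5.17) and running the linear determinant argument of Baker Ch. 11 §4
(`…RankStep.lean`); then, through the tree's reduction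
`eFunctionValuesAtAlgebraicPoints_of_rankBound` (Siegel's product trick, `…Reduction.lean`), the
catalogue declaration:

* `shidlovskii_rankBound_holds : shidlovskii_rankBound`;
* `EFunctionValuesAtAlgebraicPoints_holds : EFunctionValuesAtAlgebraicPoints`.

The bridge: coefficients, `T`, `B`, `α` are read inside `K` (`K : IntermediateField ℚ ℂ`, a
number field); conjugate bounds become house bounds (`house ≤ C^{n+1}` since every
`ψ : K → ℂ` maps `aₙ` to a root of its minimal polynomial); the denominators of the `ν`
functions are multiplied together; `T, B` are scaled by a positive integer to integral
coefficients; the functional identities `T Fᵢ′ = ∑ Bᵢⱼ Fⱼ` and `∑ cᵢ Fᵢ ≢ 0` pass to `K⟦X⟧`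
through Taylor series at `0` and the injectivity of `K⟦X⟧ → ℂ⟦X⟧`; one value `Fᵢ(α) ≠ 0` by
`eSeries_eq_zero_of_apply_eq_zero` (`T(α) ≠ 0`).

## References

* [Rivoal2024] T. Rivoal, *Les E-fonctions et G-fonctions de Siegel* (2024), Théorèmes 5.10,
  5.20, §5.3 pp. 237–241.
* A. Baker, *Transcendental Number Theory*, CUP 1975, Ch. 11 (pp. 109–114).
-/

noncomputable section

open Polynomial NumberField
open scoped Nat

namespace Literature.Barriers.Schanuel

-- The `ℚ`-algebra diamond on subfields of `ℂ`: as in `SiegelShidlovskiiRank.lean` and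
-- `…Reduction.lean`, elaborate with `IntermediateField.algebra` only, so that the statement of
-- `shidlovskii_rankBound` is met literally.
attribute [-instance] DivisionRing.toRatAlgebra

namespace SiegelShidlovskii

variable (K : IntermediateField ℚ ℂ)

/-! ### 1. Houses and minimal polynomials inside `K ⊂ ℂ` -/

/-- `house x ≤ B` as soon as every conjugate is `≤ B`. [folklore] -/
theorem house_le_of_forall_embedding [NumberField K] (x : K) {B : ℝ} (hB : 0 ≤ B)
    (h : ∀ ψ : K →+* ℂ, ‖ψ x‖ ≤ B) : house x ≤ B := by
  unfold house
  rw [pi_norm_le_iff_of_nonneg hB]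
  exact fun ψ => h ψ

/-- Every conjugate `ψ(x)` of `x ∈ K` is a root of the minimal polynomial of `x ∈ ℂ` over `ℚ`.
[folklore] -/
theorem embedding_apply_mem_rootSet [FiniteDimensional ℚ K] (x : K) (ψ : K →+* ℂ) :
    ψ x ∈ (minpoly ℚ (x : ℂ)).rootSet ℂ := by
  have hint : IsIntegral ℚ x := IsIntegral.of_finite ℚ x
  have hmin : minpoly ℚ (x : ℂ) = minpoly ℚ x :=
    minpoly.algebraMap_eq (algebraMap K ℂ).injective x
  rw [hmin, Polynomial.mem_rootSet]
  refine ⟨minpoly.ne_zero hint, ?_⟩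
  have h := Polynomial.aeval_algHom_apply ψ.toRatAlgHom x (minpoly ℚ x)
  rw [minpoly.aeval, map_zero] at h
  exact h

/-! ### 2. Strict `E`-function data read inside `K` -/

/-- **From `IsStrictEFunction` to `EData`**: `ν` strict `E`-functions with coefficients in the
number field `K` give strict `E`-function data over `K` (one normalised constant, common
denominators `∏ᵢ |Dᵢ(m)|`). [folklore] -/
theorem exists_eData [FiniteDimensional ℚ K] [NumberField K] {ν : ℕ} (a : Fin ν → ℕ → ℂ)
    (ha : ∀ i, IsStrictEFunction (a i)) (haK : ∀ i n, a i n ∈ K) :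
    ∃ E : EData K ν, ∀ i n, (E.a i n : ℂ) = a i n := by
  classical
  choose Cf hCf0 hCf using fun i => (ha i).2.2.1
  choose Df D₀f hD₀f hDf using fun i => (ha i).2.2.2
  -- one constant for everything
  set Dm : Fin ν → ℝ := fun i => max 1 (D₀f i) with hDm
  set Dprod : ℝ := ∏ i, Dm i with hDprod
  have hDm1 : ∀ i, 1 ≤ Dm i := fun i => le_max_left _ _
  have hDprod1 : 1 ≤ Dprod := by
    rw [hDprod, ← Finset.prod_const_one (s := (Finset.univ : Finset (Fin ν)))]
    exact Finset.prod_le_prod (fun _ _ => zero_le_one) fun i _ => hDm1 i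
  set Cbig : ℝ := 1 + ∑ i, Cf i + Dprod with hCbig
  have hsum0 : 0 ≤ ∑ i, Cf i := Finset.sum_nonneg fun i _ => (hCf0 i).le
  have hCbig1 : 1 ≤ Cbig := by linarith
  have hCf_le : ∀ i, Cf i ≤ Cbig := fun i => by
    have : Cf i ≤ ∑ i', Cf i' :=
      Finset.single_le_sum (f := Cf) (fun i' _ => (hCf0 i').le) (Finset.mem_univ i)
    linarith
  have hDprod_le : Dprod ≤ Cbig := by linarith
  -- the denominators
  set D : ℕ → ℕ := fun m => ∏ i, (Df i m).natAbs with hD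
  have hDf0 : ∀ i m, 0 ≤ Df i m := fun i m => le_trans zero_le_one (hDf i m).1
  have hDnat : ∀ i m, ((Df i m).natAbs : ℤ) = Df i m := fun i m => Int.natAbs_of_nonneg (hDf0 i m)
  refine ⟨{ a := fun i n => ⟨a i n, haK i n⟩
            C := Cbig
            one_le_C := hCbig1
            house_le := ?_
            D := D
            D_pos := ?_
            D_le := ?_
            isIntegral := ?_ }, fun i n => rfl⟩
  · -- house bound through the conjugates
    intro i m
    refine house_le_of_forall_embedding K _ (by positivity) fun ψ => ?_
    have hmem := embedding_apply_mem_rootSet K (⟨a i m, haK i m⟩ : K) ψ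
    calc ‖ψ ⟨a i m, haK i m⟩‖ ≤ Cf i ^ (m + 1) := hCf i m _ hmem
      _ ≤ Cbig ^ (m + 1) := pow_le_pow_left₀ (hCf0 i).le (hCf_le i) _
  · intro m
    have : 0 < D m := Finset.prod_pos fun i _ => Int.natAbs_pos.mpr (by have := (hDf i m).1; omega)
    exact this
  · intro m
    have h1 : (D m : ℝ) = ∏ i, (Df i m : ℝ) := by
      simp only [hD, Nat.cast_prod]
      refine Finset.prod_congr rfl fun i _ => ?_
      rw [Nat.cast_natAbs, abs_of_nonneg (by exact_mod_cast hDf0 i m)]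
    rw [h1]
    calc ∏ i, (Df i m : ℝ) ≤ ∏ i, Dm i ^ (m + 1) := by
          refine Finset.prod_le_prod (fun i _ => by exact_mod_cast hDf0 i m) fun i _ => ?_
          exact ((hDf i m).2.1).trans (pow_le_pow_left₀ (hD₀f i).le (le_max_right _ _) _)
      _ = Dprod ^ (m + 1) := by rw [Finset.prod_pow]
      _ ≤ Cbig ^ (m + 1) := pow_le_pow_left₀ (le_trans zero_le_one hDprod1) hDprod_le _
  · intro i m j hj
    rw [← isIntegral_algHom_iff (algebraMap K ℂ).toIntAlgHom (algebraMap K ℂ).injective]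
    show IsIntegral ℤ (algebraMap K ℂ ((D m : K) * ⟨a i j, haK i j⟩))
    rw [map_mul, map_natCast]
    have hsplit : (D m : ℂ) = (∏ i' ∈ Finset.univ.erase i, ((Df i' m).natAbs : ℂ)) * (Df i m : ℂ) := by
      simp only [hD, Nat.cast_prod]
      rw [← Finset.prod_erase_mul _ _ (Finset.mem_univ i)]
      congr 1
      rw [← Int.cast_natCast, hDnat i m]
    rw [hsplit, mul_assoc]
    refine IsIntegral.mul (IsIntegral.prod _ fun i' _ => isIntegral_natCast _) ?_
    exact (hDf i m).2.2 j hj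

/-! ### 3. Polynomials and functional identities read inside `K` -/

/-- `PowerSeries.map` commutes with `d/dX`. [folklore] -/
theorem map_derivative_powerSeries {R S : Type*} [CommSemiring R] [CommSemiring S] (ψ : R →+* S)
    (f : PowerSeries R) :
    PowerSeries.map ψ (PowerSeries.derivative R f) = PowerSeries.derivative S (PowerSeries.map ψ f) := by
  ext n
  simp only [PowerSeries.coeff_map, PowerSeries.coeff_derivative, map_mul, map_natCast, map_add,
    map_one]

/-- Taylor series of an `E`-function: `taylorPS (eSeries a) = egf a`. [folklore] -/
theorem taylorPS_eSeries_eq_egf {a : ℕ → ℂ} (h : ExpBound a) : taylorPS (eSeries a) = egf a := by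
  rw [taylorPS_eSeries h]; rfl

/-- **The differential system read formally in `ℂ⟦X⟧`** from the identity of entire functions.
[folklore] -/
theorem isSol_complex {ν : ℕ} (a : Fin ν → ℕ → ℂ) (ha : ∀ i, ExpBound (a i)) (T : ℂ[X])
    (B : Matrix (Fin ν) (Fin ν) ℂ[X])
    (hsys : ∀ i z, T.eval z * deriv (eSeries (a i)) z = ∑ j, (B i j).eval z * eSeries (a j) z) :
    IsSol (coeAlgHom ℂ) (PowerSeries.derivative ℂ) T B (fun i => egf (a i)) := by
  intro i
  have hd : ∀ i, Differentiable ℂ (eSeries (a i)) := fun i => differentiable_eSeries (ha i)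
  have hd' : Differentiable ℂ (deriv (eSeries (a i))) := by
    rw [deriv_eSeries (ha i)]; exact differentiable_eSeries (ha i).shift
  have hfun : (fun z => T.eval z * deriv (eSeries (a i)) z) =
      fun z => ∑ j, (B i j).eval z * eSeries (a j) z := funext (hsys i)
  have hl : taylorPS (fun z => T.eval z * deriv (eSeries (a i)) z) =
      (T : PowerSeries ℂ) * PowerSeries.derivative ℂ (egf (a i)) := by
    rw [show (fun z => T.eval z * deriv (eSeries (a i)) z) = (fun z => T.eval z) * deriv (eSeries (a i))
      from rfl, taylorPS_mul T.differentiable hd', taylorPS_polynomial, taylorPS_deriv,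
      taylorPS_eSeries_eq_egf (ha i)]
  have hr : taylorPS (fun z => ∑ j, (B i j).eval z * eSeries (a j) z) =
      ∑ j, ((B i j : ℂ[X]) : PowerSeries ℂ) * egf (a j) := by
    rw [taylorPS_sum Finset.univ (fun j z => (B i j).eval z * eSeries (a j) z)
      (fun j _ => (B i j).differentiable.mul (hd j))]
    refine Finset.sum_congr rfl fun j _ => ?_
    rw [show (fun z => (B i j).eval z * eSeries (a j) z) = (fun z => (B i j).eval z) * eSeries (a j)
      from rfl, taylorPS_mul (B i j).differentiable (hd j), taylorPS_polynomial,
      taylorPS_eSeries_eq_egf (ha j)]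
  show coeAlgHom ℂ T * PowerSeries.derivative ℂ (egf (a i)) = ∑ j, coeAlgHom ℂ (B i j) * egf (a j)
  simp only [coeAlgHom_apply]
  rw [← hl, hfun, hr]

/-- **Descent of the system to `K⟦X⟧`** (injectivity of `K⟦X⟧ → ℂ⟦X⟧`), with an integral
scaling factor `N`. [folklore] -/
theorem isSol_descend {ν : ℕ} (aK : Fin ν → ℕ → K) (TK : K[X]) (BK : Matrix (Fin ν) (Fin ν) K[X])
    (N : ℕ)
    (h : IsSol (coeAlgHom ℂ) (PowerSeries.derivative ℂ) (TK.map (algebraMap K ℂ))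
      (fun i j => (BK i j).map (algebraMap K ℂ)) (fun i => egf (algebraMap K ℂ ∘ aK i))) :
    IsSol (coeAlgHom K) (PowerSeries.derivative K) ((N : K[X]) * TK)
      (fun i j => (N : K[X]) * BK i j) (fun i => egf (aK i)) := by
  intro i
  apply PowerSeries.map_injective (algebraMap K ℂ) (algebraMap K ℂ).injective
  have hi := h i
  simp only [coeAlgHom_apply] at hi
  simp only [coeAlgHom_apply, map_mul, map_sum, ← Polynomial.polynomial_map_coe,
    Polynomial.map_natCast, map_derivative_powerSeries, map_egf]
  rw [mul_assoc, hi, Finset.mul_sum]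
  refine Finset.sum_congr rfl fun j _ => ?_
  ring

/-- **Independence read formally**: a formal relation `∑ pᵢ · egf aᵢ = 0` over `K` gives a
functional relation with `K`-coefficients, excluded by hypothesis. [folklore] -/
theorem indep_descend [NumberField K] {ν : ℕ} (aK : Fin ν → ℕ → K)
    (hexp : ∀ i, ExpBound (algebraMap K ℂ ∘ aK i))
    (hli : ∀ c : Fin ν → ℂ[X], (∀ i k, (c i).coeff k ∈ K) →
      (∀ z, ∑ i, (c i).eval z * eSeries (algebraMap K ℂ ∘ aK i) z = 0) → c = 0)
    (p : Fin ν → K[X]) (hp : form (coeAlgHom K) (fun i => egf (aK i)) p = 0) : p = 0 := by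
  set σ₀ : K →+* ℂ := algebraMap K ℂ with hσ₀
  have hzero : formFun σ₀ aK p = fun _ => 0 := by
    refine taylorPS_inj (differentiable_formFun σ₀ aK p hexp) (differentiable_const 0) ?_
    rw [taylorPS_formFun σ₀ aK p hexp, hp, map_zero, taylorPS_zero]
  have hc := hli (fun i => (p i).map σ₀) (fun i k => by
    rw [Polynomial.coeff_map]; exact ((p i).coeff k).2) (fun z => by
    have := congr_fun hzero z
    simpa [formFun] using this)
  funext i
  have := congr_fun hc i
  simp only [Pi.zero_apply] at this
  exact Polynomial.map_injective σ₀ σ₀.injective (by rw [this, Pi.zero_apply, Polynomial.map_zero])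

/-! ### 4. The rank theorem -/

/-- Integral coefficients after scaling. [folklore] -/
theorem isIntegral_coeff_natCast_mul {p : K[X]} {N : ℕ} {d : ℕ} (hd : p.natDegree ≤ d)
    (h : ∀ k, k ≤ d → IsIntegral ℤ ((N : K) * p.coeff k)) (s : ℕ) :
    IsIntegral ℤ (((N : K[X]) * p).coeff s) := by
  rw [← Polynomial.C_eq_natCast, Polynomial.coeff_C_mul]
  by_cases hs : s ≤ d
  · exact h s hs
  · rw [Polynomial.coeff_eq_zero_of_natDegree_lt (by omega), mul_zero]
    exact isIntegral_zero

/-- **Rivoal Thm. 5.20 (first bound), `Fin ν`-indexed.** [folklore] -/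
theorem rankBound_fin [FiniteDimensional ℚ K] (ν : ℕ)
    (a : Fin ν → ℕ → ℂ) (ha : ∀ i, IsStrictEFunction (a i)) (haK : ∀ i k, a i k ∈ K)
    (T : ℂ[X]) (B : Matrix (Fin ν) (Fin ν) ℂ[X]) (hT : ∀ k, T.coeff k ∈ K)
    (hB : ∀ i j k, (B i j).coeff k ∈ K)
    (hsys : ∀ i z, T.eval z * deriv (eSeries (a i)) z = ∑ j, (B i j).eval z * eSeries (a j) z)
    (hli : ∀ c : Fin ν → ℂ[X], (∀ i k, (c i).coeff k ∈ K) →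
      (∀ z, ∑ i, (c i).eval z * eSeries (a i) z = 0) → c = 0)
    (α : ℂ) (hαK : α ∈ K) (hα0 : α ≠ 0) (hTα : T.eval α ≠ 0) :
    ν ≤ Module.finrank ℚ K *
      Module.finrank K (Submodule.span K (Set.range fun i => eSeries (a i) α)) := by
  classical
  rcases Nat.eq_zero_or_pos ν with hν0 | hν
  · exact hν0.le.trans (Nat.zero_le _)
  haveI : NumberField K := NumberField.of_module_finite ℚ K
  have hexp : ∀ i, ExpBound (a i) := fun i => (ha i).expBound
  -- one value is non-zero (regularity of `α`)
  have hw : ∃ i, eSeries (a i) α ≠ 0 := by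
    by_contra hall
    push Not at hall
    have hz := eSeries_eq_zero_of_apply_eq_zero a hexp T B hsys hTα hall ⟨0, hν⟩
    have hc := hli (Pi.single ⟨0, hν⟩ 1) (fun i k => ?_) (fun z => ?_)
    · have := congr_fun hc ⟨0, hν⟩
      simp at this
    · rw [Pi.single_apply]
      split_ifs
      · rw [Polynomial.coeff_one]
        split_ifs
        · exact one_mem K
        · exact zero_mem K
      · rw [Polynomial.coeff_zero]; exact zero_mem K
    · rw [Finset.sum_eq_single ⟨0, hν⟩]
      · rw [hz]; simp
      · intro i _ hi; rw [Pi.single_apply, if_neg hi]; simp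
      · intro h; exact absurd (Finset.mem_univ _) h
  -- the data read inside `K`
  obtain ⟨E, hE⟩ := exists_eData K a ha haK
  have haE : ∀ i, (algebraMap K ℂ) ∘ E.a i = a i := fun i => funext fun n => hE i n
  obtain ⟨TK, hTK⟩ := exists_map_eq_of_coeff_mem K T hT
  choose BK hBK using fun p : Fin ν × Fin ν => exists_map_eq_of_coeff_mem K (B p.1 p.2) (hB p.1 p.2)
  -- integral scaling of `T`, `B`
  set dmax : ℕ := TK.natDegree + ∑ p : Fin ν × Fin ν, (BK p).natDegree with hdmax
  have hdT : TK.natDegree ≤ dmax := Nat.le_add_right _ _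
  have hdB : ∀ p, (BK p).natDegree ≤ dmax := fun p =>
    (Finset.single_le_sum (f := fun p => (BK p).natDegree) (fun _ _ => Nat.zero_le _)
      (Finset.mem_univ p)).trans (Nat.le_add_left _ _)
  obtain ⟨N, hN, hNint⟩ := exists_nat_mul_isIntegral_family K
    (fun q : Option (Fin ν × Fin ν) × Fin (dmax + 1) =>
      q.1.elim (TK.coeff q.2) fun p => (BK p).coeff q.2)
  set f : K[X] := (N : K[X]) * TK with hf
  set G : Matrix (Fin ν) (Fin ν) K[X] := fun i j => (N : K[X]) * BK (i, j) with hG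
  have hfint : ∀ s, IsIntegral ℤ (f.coeff s) :=
    isIntegral_coeff_natCast_mul K hdT fun k hk => hNint (none, ⟨k, Nat.lt_succ_of_le hk⟩)
  have hGint : ∀ h i s, IsIntegral ℤ ((G h i).coeff s) := fun h i =>
    isIntegral_coeff_natCast_mul K (hdB (h, i)) fun k hk => hNint (some (h, i), ⟨k, Nat.lt_succ_of_le hk⟩)
  -- `α` inside `K`, with a denominator
  set αK : K := ⟨α, hαK⟩ with hαK'
  obtain ⟨l, hl, hlα⟩ := exists_nat_mul_isIntegral K αK
  -- the functional identities read formally over `K`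
  have hBmat : (fun i j => (BK (i, j)).map (algebraMap K ℂ)) = B :=
    funext fun i => funext fun j => hBK (i, j)
  have hEgf : (fun i => egf ((algebraMap K ℂ) ∘ E.a i)) = fun i => egf (a i) :=
    funext fun i => by rw [haE i]
  have hsolC : IsSol (coeAlgHom ℂ) (PowerSeries.derivative ℂ) (TK.map (algebraMap K ℂ))
      (fun i j => (BK (i, j)).map (algebraMap K ℂ)) (fun i => egf ((algebraMap K ℂ) ∘ E.a i)) := by
    rw [hTK, hBmat, hEgf]
    exact isSol_complex a hexp T B hsys
  have hsol := isSol_descend K E.a TK (fun i j => BK (i, j)) N hsolC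
  have hexpK : ∀ i, ExpBound ((algebraMap K ℂ) ∘ E.a i) := fun i => by rw [haE]; exact hexp i
  have hindep : ∀ p : Fin ν → K[X], form (coeAlgHom K) (fun i => egf (E.a i)) p = 0 → p = 0 :=
    indep_descend K E.a hexpK (fun c hc hz => hli c hc fun z => by simpa only [haE] using hz z)
  have hfα : f.eval αK ≠ 0 := by
    intro h0
    have h1 : (algebraMap K ℂ) (TK.eval αK) = T.eval α := by
      have h1' : (TK.map (algebraMap K ℂ)).eval ((algebraMap K ℂ) αK) =
          (algebraMap K ℂ) (TK.eval αK) := by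
        rw [Polynomial.eval_map, Polynomial.eval₂_at_apply]
      rw [← h1', hTK]
      rfl
    have h2 : (algebraMap K ℂ) (f.eval αK) = (N : ℂ) * T.eval α := by
      rw [hf, Polynomial.eval_mul, Polynomial.eval_natCast, map_mul, map_natCast, h1]
    rw [h0, map_zero] at h2
    have hN0 : (N : ℂ) ≠ 0 := by exact_mod_cast hN.ne'
    exact hTα ((mul_eq_zero.mp h2.symm).resolve_left hN0)
  have hαK0 : αK ≠ 0 := fun h => hα0 (by simpa [hαK'] using congr_arg Subtype.val h)
  -- Baker's data
  set Λ : L4Data K ν :=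
    { toEData := E
      f := f
      G := G
      f_integral := hfint
      G_integral := hGint
      sol := hsol
      indep := hindep
      α := αK
      α_ne_zero := hαK0
      eval_ne_zero := hfα
      l := l
      one_le_l := hl
      lα_integral := hlα } with hΛ
  -- Lemma 4 and the rank step
  refine rank_bound_of_small_forms K (fun i => eSeries (a i) α) hw fun ε hε => ?_
  obtain ⟨r₀, hr₀⟩ := lemma4 Λ hν (algebraMap K ℂ) hε
  refine ⟨r₀, fun r hr => ?_⟩
  obtain ⟨q, hqint, hqdet, hqH, hqS⟩ := hr₀ r hr
  refine ⟨q, hqint, hqdet, fun i j σ => ?_, fun j => ?_⟩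
  · exact (norm_embedding_le_house (q i j) σ.toRingHom).trans (hqH i j)
  · have h := hqS j
    have hfun : ∀ i, eSeries ((algebraMap K ℂ) ∘ Λ.a i) ((algebraMap K ℂ) Λ.α) = eSeries (a i) α :=
      fun i => by rw [show Λ.a = E.a from rfl, haE i]; rfl
    have hcoe : ∀ y : K, (algebraMap K ℂ) y = (y : ℂ) := fun y => rfl
    simp only [hfun] at h
    simpa only [hcoe] using h

/-- **Shidlovskii's rank theorem holds** (Rivoal Thm. 5.20, first bound: `#ι ≤ [K:ℚ] · rank_K`),
discharging the named fact `shidlovskii_rankBound` of `SiegelShidlovskiiRank.lean`. The proof is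
Baker's: Lemmas 1–4 of Ch. 11 over the number field `K` (`…Lemma4.lean`), the linear
determinant/Liouville argument of §4 (`…RankStep.lean`), and the bridge of this file.
[cite: Rivoal2024, Théorème 5.20] -/
theorem rankBound_holds : shidlovskii_rankBound := by
  intro K _ ι _ _ a ha haK T B hT hB hsys hli α hαK hα0 hTα
  classical
  set ν := Fintype.card ι with hν
  set e : ι ≃ Fin ν := Fintype.equivFin ι with he
  have h := rankBound_fin K ν (fun i => a (e.symm i)) (fun i => ha _) (fun i k => haK _ k) T
    (fun i j => B (e.symm i) (e.symm j)) hT (fun i j k => hB _ _ k)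
    (fun i z => by
      rw [hsys]
      exact Fintype.sum_equiv e _ _ fun j => by simp)
    (fun c hc hz => by
      have h' := hli (c ∘ e) (fun i k => hc _ k) fun z => by
        rw [← hz z]
        exact Fintype.sum_equiv e _ _ fun j => by simp
      funext i
      have := congr_fun h' (e.symm i)
      simpa using this)
    α hαK hα0 hTα
  rw [show (fun i => eSeries (a (e.symm i)) α) = (fun x => eSeries (a x) α) ∘ e.symm from rfl,
    e.symm.surjective.range_comp] at h
  exact h

end SiegelShidlovskii

/-- **Discharge of the named fact `shidlovskii_rankBound`** (Rivoal Thm. 5.20, first bound).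
[cite: Rivoal2024, Théorème 5.20] -/
theorem shidlovskii_rankBound_holds : shidlovskii_rankBound :=
  SiegelShidlovskii.rankBound_holds

/-- **Discharge of `siegelShidlovskii_algIndep`** — the Siegel–Shidlovskii theorem
(Rivoal Thm. 5.10; Baker Thm. 11.1): for strict `E`-functions with a differential system and
`(z, F₁, …, Fₙ)` algebraically independent over `ℚ̄`, the values at an algebraic `α` with
`αT(α) ≠ 0` are algebraically independent over `ℚ̄`. [cite: Rivoal2024, Théorème 5.10] -/
theorem siegelShidlovskii_algIndep_holds : siegelShidlovskii_algIndep :=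
  siegelShidlovskii_algIndep_of_rankBound shidlovskii_rankBound_holds

/-- **Discharge of the catalogue declaration `EFunctionValuesAtAlgebraicPoints`**
(Siegel–Shidlovskii; Baker 1975 Thm. 11.1 = Rivoal 2024 Thm. 5.10). [cite: Rivoal2024, Théorème 5.10] -/
theorem EFunctionValuesAtAlgebraicPoints_holds : EFunctionValuesAtAlgebraicPoints :=
  eFunctionValuesAtAlgebraicPoints_of_rankBound shidlovskii_rankBound_holds



end Literature.Barriers.Schanuel

end
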